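import Summits.QuantumFields.BalabanUV.Beta.EriceFlowEnclosureB12AsPrintedHistoryContagionShiftFlowZeroLambda

/-!
# Beta / EriceFlowEnclosureB12AsPrintedHistoryContagionShiftFlowZeroIsometry — ASYMPTOTIC FREEDOM IS CONTAGIOUS, part 44: THE Λ-COORDINATE IS ASYMPTOTICALLY ISOMETRIC TO THE
# CHART, AND ONE-LOOP ASYMPTOTIC SCALING.  Parts 34–35 gave the relative Λ-parameter of the trajectories near zero pin as a function Λ of the pin, bi-Lipschitz in the chart
# `x = 1∕g²` with the constants (2∕3, 4∕3), and its ABEL EQUATION `Λ(h k) = Λ e + kβ₀`; part 40 gave the absolute two-loop coordinate Λ₂ with the same Abel equation.  Both are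
# instances of ONE notion, used from here on as the interface: a **DYNAMICAL ABEL FUNCTION with comparison sequence `a`** is a function Λ with
# `1∕h(n)² − a(n) → Λ(e)` along EVERY box solution h from every pin `e ∈ ]0, e′]` (relative Λ: `a = 1∕h′²`; two-loop Λ₂: `a(n) = nβ₀ + (b₁∕β₀)·log n`).  For EVERY such
# Λ (§68): the Abel equation **`Λ(h k) = Λ e + kβ₀`** holds (`dynAbel_shift` — the comparison sequence cancels), any two differ by a CONSTANT (`dynAbel_sub_dynAbel`), and —
# the point of this part — **Λ IS ASYMPTOTICALLY ISOMETRIC TO THE CHART AT THE ZERO PIN**: for `0 < g ≤ g̃ ≤ e′`,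
# **`|(Λ g − Λ g̃) − (1∕g² − 1∕g̃²)| ≤ (64C_m∕(3(1 − θ)β*))·g̃·(1∕g² − 1∕g̃²)`** (`abs_dynAbel_sub_sub_chart_le`): the bi-Lipschitz constants of part 35 are `1 ± κg̃`
# and TEND TO ONE — the rate of part 34's relative Λ read at depth zero with a sliding reference pin.  Consequences (§69): ONE-LOOP ASYMPTOTIC SCALING
# **`|Λ g − Λ e′ − (1∕g² − 1∕e′²)| ≤ (8C_m∕((1 − θ)β*))·(1∕g) + (64C_m∕(3(1 − θ)β*))·e′·(β₀ + C_mγ∕(1 − θ))`** on the whole pin interval (`abs_dynAbel_sub_chart_le`: bracket g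
# between two consecutive points of the reference trajectory, climb the reference by part 33's one-loop law, cross over by the isometry), whence **`g²·(Λ g − Λ e′) → 1` as
# `g → 0⁺`** (`tendsto_sq_mul_dynAbel`): to leading order THE Λ-PARAMETER IS THE INVERSE SQUARED COUPLING — the flow-with-memory form of «asymptotic scaling»; and the
# isometry is exactly LÉVY's criterion singling out the PRINCIPAL Abel function of the renormalization step (part 45 `…ZeroPrincipal`: uniqueness; part 46: the canonical
# continuous renormalization group it generates).
# Abstract in B (β-flow team, prover 1, unit `b2b-balaban-beta-bflow-p1`, gen 40; ROW AP-I·Uc × NODE U2 × ROW Λ — the Λ-coordinate at the zero pin)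

HONEST FRAMING (page 1 of everything the β sub-cell writes): discharging `BetaPertH` makes Bałaban's UV stability UNCONDITIONAL — a
real constructive-QFT result; it is NOT the continuum limit and NOT the Clay problem.  HONEST DEPENDENCY (cell reorg 2026-08-19,
verbatim): «continuum YM on T⁴ ⇐ BetaPertH ∧ nine spine estimates (0/9 proved); BetaPertH ⇐ (D1) ∧ (D4) ∧ CAP+tail; G-an2-4 gates
asym, D1 and NE2/3/4.»  THIS MODULE DISCHARGES NOTHING: elementary real analysis (limits of differences, a bracketing index, a three-term estimate) over node U2's HYPOTHESIS
SHAPES `T4BetaStationary.{SeqBox, MemoryProfile}`, `T4BetaFlowWellPosed.{MemFlow, solution}` on an ABSTRACT functional `B`; part 34's `exists_relativeLambda ∕ package_of_le ∕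
le_envelope_of_reference_flow ∕ succ_le_of_reference_flow`, part 33's `tendsto_invSq_shift_sub ∕ abs_invSq_sub_oneLoop_le_of_reference_flow`, part 32's `tsum_weighted_le`,
part 13's `memFlow_solution_of_reference`, part 10's `invSq_lower_of_reference_flow`, d4-p2's `memFlow_tail` and node U2's `T4CouplingMatching.sprof` BY NAME — nothing restated.
PRECEDENTS (by name, not imported): gen 15's #39 `EriceFlowEnclosureAsymptoticScaling` (the Markov ∕ Erice picture: `t·Λ t → 1` under the Lipschitz clause (L)) and gen 14's #38
`EriceFlowEnclosureAbelCoordinate`; here the flow has MEMORY, there is no floor and no Lipschitz clause in g², and the input is one AF reference.  The isometry is the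
hypothesis of Lévy's ∕ Szekeres' uniqueness criterion for Abel functions («principal» solutions; G. Szekeres, Acta Math. 100 (1958) 203–258; survey M. C. Zdun, ESAIM Proc. 46
(2014) §1) — used in part 45, cited as precedent only.  `ScaleShiftRate` (GAPS G-t4-U2-1), `HistLipschitz`∕`FadingMemory` (G-t4-U2-2), [I] THEOREM 2 (p. 259, STATED WITHOUT
PROOF) do not occur in this abstract part (carrier END: part 50); NOTHING is asserted about Bałaban's actual β.  [I] = T. Bałaban, Commun. Math. Phys. **109** (1987) 249–301
[Balaban1987RG1].

WHAT THIS FILE PROVES (0 sorry, 0 def): §68 `tendsto_sub_of_dynAbel`, **`dynAbel_shift`**, `dynAbel_sub_dynAbel`, **`abs_dynAbel_sub_sub_chart_le`**; §69 `exists_bracket`,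
`invSq_succ_sub_le`, **`abs_dynAbel_sub_chart_le`**, **`tendsto_sq_mul_dynAbel`**.  NOT CLAIMED: an absolute expansion `Λ g = 1∕g² + const + o(1)` (false at one loop: the
defect is of order 1∕g, part 37); the two-loop expansion is part 49; anything about Bałaban's β; `BetaPertH`; continuum; Clay.
-/

namespace Summit.QuantumFields.BalabanUV.Beta.EriceFlowEnclosureB12AsPrintedHistoryContagionShiftFlowZeroIsometry

open Finset Filter Topology Set
open Literature.MathematicalPhysics.QuantumFieldTheory.Balaban1983to89
open Literature.MathematicalPhysics.QuantumFieldTheory.Balaban1983to89.T4CouplingMatching (sprof sprof_pos sprof_zero)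
open Literature.MathematicalPhysics.QuantumFieldTheory.Balaban1983to89.T4BetaStationary (SeqBox MemoryProfile)
open Literature.MathematicalPhysics.QuantumFieldTheory.Balaban1983to89.T4BetaFlowWellPosed (MemFlow solution seqBox_shift)
open Summit.QuantumFields.BalabanUV.Beta.EriceRemainderEnclosureHistoryAutonomyOrder (memFlow_tail)
open Summit.QuantumFields.BalabanUV.Beta.EriceFlowEnclosureB12AsPrintedHistoryContagionShiftFlow (invSq_lower_of_reference_flow)
open Summit.QuantumFields.BalabanUV.Beta.EriceFlowEnclosureB12AsPrintedHistoryContagionShiftFlowPicardLimit (memFlow_solution_of_reference)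
open Summit.QuantumFields.BalabanUV.Beta.EriceFlowEnclosureB12AsPrintedHistoryContagionShiftFlowZero (tsum_weighted_le)
open Summit.QuantumFields.BalabanUV.Beta.EriceFlowEnclosureB12AsPrintedHistoryContagionShiftFlowZeroClock (tendsto_invSq_shift_sub
  abs_invSq_sub_oneLoop_le_of_reference_flow)
open Summit.QuantumFields.BalabanUV.Beta.EriceFlowEnclosureB12AsPrintedHistoryContagionShiftFlowZeroOffset (package_of_le le_envelope_of_reference_flow
  succ_le_of_reference_flow exists_relativeLambda)

noncomputable section

/-! ## §68 Dynamical Abel functions: the Abel equation, rigidity up to constants, asymptotic chart-isometry at the zero pin -/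

/-- For a dynamical Abel function Λ (comparison sequence `a`), the chart difference of two trajectories converges to the difference of the Λ-values of their pins — the
comparison sequence cancels. [folklore] -/
theorem tendsto_sub_of_dynAbel {B : (ℕ → ℝ) → ℝ} {γ e' e₁ e₂ : ℝ} {a : ℕ → ℝ} {Λ : ℝ → ℝ} {h₁ h₂ : ℕ → ℝ}
    (hΛ : ∀ e ∈ Ioc (0 : ℝ) e', ∀ h : ℕ → ℝ, SeqBox γ h → MemFlow B e h → Tendsto (fun n => 1 / h n ^ 2 - a n) atTop (𝓝 (Λ e)))
    (he₁ : e₁ ∈ Ioc (0 : ℝ) e') (hh₁s : SeqBox γ h₁) (hh₁f : MemFlow B e₁ h₁)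
    (he₂ : e₂ ∈ Ioc (0 : ℝ) e') (hh₂s : SeqBox γ h₂) (hh₂f : MemFlow B e₂ h₂) :
    Tendsto (fun n => 1 / h₁ n ^ 2 - 1 / h₂ n ^ 2) atTop (𝓝 (Λ e₁ - Λ e₂)) :=
  ((hΛ e₁ he₁ h₁ hh₁s hh₁f).sub (hΛ e₂ he₂ h₂ hh₂s hh₂f)).congr fun n => by ring

/-- **THE ABEL EQUATION HOLDS FOR EVERY DYNAMICAL ABEL FUNCTION.**  `B` with memory profile `(C_m, θ)` on ]0, γ]^ℕ and the value β₀ at the zero history; ONE AF reference t;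
the pin `e ∈ ]0, e′]` carries part 10's package (`4C_m e ≤ β*(1 − θ)`, `e²·Q ≤ 3∕4`); Λ a dynamical Abel function with ANY comparison sequence `a`.  THEN along every box
solution h from e: **`Λ(h k) = Λ e + k·β₀`** — the running value `h k` is a pin whose trajectory is the tail of h, and the chart increment over k scales tends to `kβ₀`
(part 33); the comparison sequence cancels.  (Part 35 is the case `a = 1∕h′²`, part 40 the case `a(n) = nβ₀ + (b₁∕β₀) log n`.) [folklore] -/
theorem dynAbel_shift {B : (ℕ → ℝ) → ℝ} {Cm θ γ β₀ bs ta gs e' e : ℝ} {t : ℕ → ℝ} {a : ℕ → ℝ} {Λ : ℝ → ℝ} {h : ℕ → ℝ}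
    (hB : MemoryProfile Cm θ γ B) (hCm : 0 ≤ Cm) (hθ0 : 0 ≤ θ) (hθ1 : θ < 1) (hbs : 0 < bs) (hta : 0 < ta)
    (h0 : ∀ u : ℕ → ℝ, SeqBox γ u → |B u - β₀| ≤ Cm * ∑' j, θ ^ j * u j)
    (hts : SeqBox γ t) (htf : MemFlow B gs t) (hprof : ∀ m : ℕ, 1 / ta ^ 2 + bs * (m : ℝ) ≤ 1 / (t m) ^ 2)
    (hΛ : ∀ e ∈ Ioc (0 : ℝ) e', ∀ h : ℕ → ℝ, SeqBox γ h → MemFlow B e h → Tendsto (fun n => 1 / h n ^ 2 - a n) atTop (𝓝 (Λ e)))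
    (he : e ∈ Ioc (0 : ℝ) e') (hhs : SeqBox γ h) (hhf : MemFlow B e h)
    (hs1 : 4 * Cm * e ≤ bs * (1 - θ))
    (hs2 : e ^ 2 * (1 / gs ^ 2 + Cm * γ / (1 - θ) ^ 2 + (2 * Cm / ((1 - θ) * bs)) ^ 2) ≤ 3 / 4) (k : ℕ) :
    Λ (h k) = Λ e + (k : ℝ) * β₀ := by
  have hmono := succ_le_of_reference_flow hB hCm hθ0 hθ1 hbs hta h0 hts htf hprof hhs hhf hs1 hs2 k
  have hkmem : h k ∈ Ioc (0 : ℝ) e' := ⟨(hhs k).1, hmono.2.2.trans he.2⟩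
  have htail := hΛ (h k) hkmem (fun j => h (k + j)) (seqBox_shift hhs k) (memFlow_tail hhf k)
  have hlim := hΛ e he h hhs hhf
  have hprofh : ∀ m : ℕ, 1 / (2 * e) ^ 2 + bs / 4 * (m : ℝ) ≤ 1 / (h m) ^ 2 := fun m => by
    have := invSq_lower_of_reference_flow hB hCm hθ0 hθ1 hbs hta hts htf hprof hhs hhf hs1 hs2 m
    rwa [show (1 : ℝ) / (2 * e) ^ 2 = 1 / (4 * e ^ 2) by ring]
  have hshift := tendsto_invSq_shift_sub hCm hθ0 hθ1 (by positivity : 0 < bs / 4) (by have := he.1; positivity : 0 < 2 * e)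
    h0 hhs hhf hprofh k
  have hdiff : Tendsto (fun n => (1 / h (k + n) ^ 2 - a n) - (1 / h n ^ 2 - a n)) atTop (𝓝 (Λ (h k) - Λ e)) := htail.sub hlim
  have hdiff' : Tendsto (fun n => (1 / h (k + n) ^ 2 - a n) - (1 / h n ^ 2 - a n)) atTop (𝓝 ((k : ℝ) * β₀)) :=
    hshift.congr fun n => by rw [Nat.add_comm]; ring
  linarith [tendsto_nhds_unique hdiff hdiff']

/-- **TWO DYNAMICAL ABEL FUNCTIONS DIFFER BY A CONSTANT** (whatever their comparison sequences): near zero pin (part 13's package at every pin of ]0, e′], from the package at e′),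
`Λ e − Λ′ e = Λ e′ − Λ′ e′` for every `e ∈ ]0, e′]` — both differences are the limit of `a′(n) − a(n)`.  So every construction built from a dynamical Abel function up to its
additive constant (part 46's continuous renormalization group) is independent of WHICH one is used: reference pin, one loop or two loops. [folklore] -/
theorem dynAbel_sub_dynAbel {B : (ℕ → ℝ) → ℝ} {Cm θ γ bs ta gs e' e : ℝ} {t : ℕ → ℝ} {a a' : ℕ → ℝ} {Λ Λ' : ℝ → ℝ}
    (hB : MemoryProfile Cm θ γ B) (hCm : 0 ≤ Cm) (hθ0 : 0 ≤ θ) (hθ1 : θ < 1) (hbs : 0 < bs) (hta : 0 < ta)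
    (hts : SeqBox γ t) (htf : MemFlow B gs t) (hprof : ∀ m : ℕ, 1 / ta ^ 2 + bs * (m : ℝ) ≤ 1 / (t m) ^ 2)
    (hΛ : ∀ e ∈ Ioc (0 : ℝ) e', ∀ h : ℕ → ℝ, SeqBox γ h → MemFlow B e h → Tendsto (fun n => 1 / h n ^ 2 - a n) atTop (𝓝 (Λ e)))
    (hΛ' : ∀ e ∈ Ioc (0 : ℝ) e', ∀ h : ℕ → ℝ, SeqBox γ h → MemFlow B e h → Tendsto (fun n => 1 / h n ^ 2 - a' n) atTop (𝓝 (Λ' e)))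
    (he' : 0 < e') (h2e' : 2 * e' ≤ γ)
    (hs1 : 4 * Cm * e' ≤ bs * (1 - θ))
    (hs2 : e' ^ 2 * (1 / gs ^ 2 + Cm * γ / (1 - θ) ^ 2 + (2 * Cm / ((1 - θ) * bs)) ^ 2) ≤ 3 / 4)
    (hs4 : 64 * Cm * e' ^ 3 ≤ (1 - θ) ^ 2) (hs5 : Cm * (8 * e' ^ 3 + 16 * e' / bs) ≤ (1 - θ) / 4) (he : e ∈ Ioc (0 : ℝ) e') :
    Λ e - Λ' e = Λ e' - Λ' e' := by
  have hγ : 0 ≤ γ := by linarith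
  -- along THE solution from a pin p, `Λ p − Λ′ p = lim (a′ n − a n)`
  have key : ∀ p ∈ Ioc (0 : ℝ) e', Tendsto (fun n => a' n - a n) atTop (𝓝 (Λ p - Λ' p)) := by
    intro p hp
    obtain ⟨p1, p2, p4, -⟩ := package_of_le hCm hθ1 hbs hγ hp.1 hp.2 hs1 hs2 hs4 hs5
    obtain ⟨hss, hsf, -, -⟩ := memFlow_solution_of_reference hB hCm hθ0 hθ1 hbs hta hts htf hprof hp.1 (by linarith [hp.2]) p1 p2 p4
    exact ((hΛ p hp _ hss hsf).sub (hΛ' p hp _ hss hsf)).congr fun n => by ring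
  have h1 := key e he
  have h2 := key e' ⟨he', le_rfl⟩
  exact tendsto_nhds_unique h1 h2

/-- **ASYMPTOTIC CHART-ISOMETRY OF EVERY DYNAMICAL ABEL FUNCTION AT THE ZERO PIN.**  `B` with memory profile `(C_m, θ)` on ]0, γ]^ℕ (0 ≤ θ < 1, C_m ≥ 0); ONE AF reference
t (`MemFlow B g* t`, `1∕t_a² + β*·m ≤ 1∕t(m)²`); the reference pin e′ with part 14's package (`2e′ ≤ γ`, `4C_m e′ ≤ β*(1 − θ)`, `e′²·Q ≤ 3∕4`, `64C_m e′³ ≤ (1 − θ)²`,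
`C_m(8e′³ + 16e′∕β*) ≤ (1 − θ)∕4`); Λ a dynamical Abel function (any comparison sequence).  THEN for all `0 < g ≤ g̃ ≤ e′`:
**`|(Λ g − Λ g̃) − (1∕g² − 1∕g̃²)| ≤ (64C_m∕(3(1 − θ)β*))·g̃·(1∕g² − 1∕g̃²)`** — the chart-Lipschitz constants of Λ on ]0, g̃] are `1 ± κg̃` and TEND TO ONE at the zero pin:
`Λ g − Λ g̃` is the relative Λ-parameter of the trajectories from g and g̃, and part 34's rate `|Θ − D(n)| ≤ (32C_m∕(3(1−θ)β*))·Δ₀·c_n` read AT DEPTH ZERO with the reference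
pin slid down to g̃ (`c_0 = 2g̃`).  This is Lévy's asymptotic-translation property in the chart — the criterion of part 45. [folklore; criterion: Szekeres 1958] -/
theorem abs_dynAbel_sub_sub_chart_le {B : (ℕ → ℝ) → ℝ} {Cm θ γ bs ta gs e' : ℝ} {t : ℕ → ℝ} {a : ℕ → ℝ} {Λ : ℝ → ℝ}
    (hB : MemoryProfile Cm θ γ B) (hCm : 0 ≤ Cm) (hθ0 : 0 ≤ θ) (hθ1 : θ < 1) (hbs : 0 < bs) (hta : 0 < ta)
    (hts : SeqBox γ t) (htf : MemFlow B gs t) (hprof : ∀ m : ℕ, 1 / ta ^ 2 + bs * (m : ℝ) ≤ 1 / (t m) ^ 2)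
    (hΛ : ∀ e ∈ Ioc (0 : ℝ) e', ∀ h : ℕ → ℝ, SeqBox γ h → MemFlow B e h → Tendsto (fun n => 1 / h n ^ 2 - a n) atTop (𝓝 (Λ e)))
    (h2e' : 2 * e' ≤ γ)
    (hs1 : 4 * Cm * e' ≤ bs * (1 - θ))
    (hs2 : e' ^ 2 * (1 / gs ^ 2 + Cm * γ / (1 - θ) ^ 2 + (2 * Cm / ((1 - θ) * bs)) ^ 2) ≤ 3 / 4)
    (hs4 : 64 * Cm * e' ^ 3 ≤ (1 - θ) ^ 2) (hs5 : Cm * (8 * e' ^ 3 + 16 * e' / bs) ≤ (1 - θ) / 4)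
    {g g' : ℝ} (hg : 0 < g) (hgg' : g ≤ g') (hg'e' : g' ≤ e') :
    |(Λ g - Λ g') - (1 / g ^ 2 - 1 / g' ^ 2)| ≤ 64 * Cm / (3 * (1 - θ) * bs) * g' * (1 / g ^ 2 - 1 / g' ^ 2) := by
  have hγ : 0 ≤ γ := by linarith
  have hg' : 0 < g' := hg.trans_le hgg'
  have hgmem : g ∈ Ioc (0 : ℝ) e' := ⟨hg, hgg'.trans hg'e'⟩
  have hg'mem : g' ∈ Ioc (0 : ℝ) e' := ⟨hg', hg'e'⟩
  -- the package slides down to the pin g′, and THE solutions from g and g′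
  obtain ⟨q1, q2, q4, q5⟩ := package_of_le hCm hθ1 hbs hγ hg' hg'e' hs1 hs2 hs4 hs5
  obtain ⟨p1, p2, p4, -⟩ := package_of_le hCm hθ1 hbs hγ hg hgg' q1 q2 q4 q5
  obtain ⟨hgs, hgf, -, -⟩ := memFlow_solution_of_reference hB hCm hθ0 hθ1 hbs hta hts htf hprof hg (by linarith [hgg', hg'e']) p1 p2 p4
  obtain ⟨hg's, hg'f, -, -⟩ := memFlow_solution_of_reference hB hCm hθ0 hθ1 hbs hta hts htf hprof hg' (by linarith [hg'e']) q1 q2 q4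
  -- the chart difference of the two trajectories tends to Λ g − Λ g′ …
  have hlim := tendsto_sub_of_dynAbel hΛ hgmem hgs hgf hg'mem hg's hg'f
  -- … and is part 34's relative Λ-parameter with reference pin g′, whose rate at depth 0 is the claim
  obtain ⟨Θ, hΘ, -, -, hrate⟩ := exists_relativeLambda hB hCm hθ0 hθ1 hbs hta hts htf hprof hg hgg' (by linarith [hg'e']) q1 q2 q4 q5
    hgs hgf hg's hg'f
  have hΘeq : Θ = Λ g - Λ g' := tendsto_nhds_unique hΘ hlim
  have h0 := hrate 0
  rw [hgf.1, hg'f.1, sprof_zero (by positivity : (0 : ℝ) < 2 * g'), hΘeq] at h0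
  calc |(Λ g - Λ g') - (1 / g ^ 2 - 1 / g' ^ 2)| ≤ 32 * Cm / (3 * (1 - θ) * bs) * (1 / g ^ 2 - 1 / g' ^ 2) * (1 / (1 / (2 * g'))) := h0
    _ = 64 * Cm / (3 * (1 - θ) * bs) * g' * (1 / g ^ 2 - 1 / g' ^ 2) := by
      rw [one_div_one_div]; ring

/-! ## §69 One-loop asymptotic scaling: `Λ g − Λ e′ = 1∕g² − 1∕e′² + O(1∕g)` and `g²·(Λ g − Λ e′) → 1` -/

/-- Bracketing a small coupling between two consecutive points of a trajectory that starts above it and tends to zero. [folklore] -/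
theorem exists_bracket {h : ℕ → ℝ} {e' g : ℝ} (hh0 : h 0 = e') (hlim : Tendsto h atTop (𝓝 0)) (hg : 0 < g) (hge' : g ≤ e') :
    ∃ m : ℕ, h (m + 1) < g ∧ g ≤ h m := by
  classical
  have hex : ∃ m, h m < g := ((tendsto_order.1 hlim).2 g hg).exists
  have h0 : ¬ h 0 < g := by rw [hh0]; exact not_lt.mpr hge'
  have hpos : 0 < Nat.find hex := by
    rcases Nat.eq_zero_or_pos (Nat.find hex) with h | h
    · exact absurd (h ▸ Nat.find_spec hex) h0
    · exact h
  refine ⟨Nat.find hex - 1, ?_, ?_⟩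
  · rw [Nat.sub_add_cancel hpos]; exact Nat.find_spec hex
  · exact not_lt.mp (Nat.find_min hex (Nat.sub_lt hpos Nat.one_pos))

/-- One chart increment of a box solution is at most `β₀ + C_mγ∕(1 − θ)` (the value-at-zero letter caps B on the box). [folklore] -/
theorem invSq_succ_sub_le {B : (ℕ → ℝ) → ℝ} {Cm θ γ β₀ e : ℝ} {h : ℕ → ℝ} (hCm : 0 ≤ Cm) (hθ0 : 0 ≤ θ) (hθ1 : θ < 1)
    (h0 : ∀ u : ℕ → ℝ, SeqBox γ u → |B u - β₀| ≤ Cm * ∑' j, θ ^ j * u j) (hhs : SeqBox γ h) (hhf : MemFlow B e h) (m : ℕ) :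
    1 / h (m + 1) ^ 2 - 1 / h m ^ 2 ≤ β₀ + Cm * γ / (1 - θ) := by
  have hu := seqBox_shift hhs (m + 1)
  have h1 := h0 _ hu
  have h2 := tsum_weighted_le hθ0 hθ1 hu
  rw [hhf.2 m]
  have h3 : Cm * ∑' j, θ ^ j * h (m + 1 + j) ≤ Cm * (γ / (1 - θ)) := mul_le_mul_of_nonneg_left h2 hCm
  have h4 := (abs_le.mp h1).2
  calc 1 / h m ^ 2 + B (fun j => h (m + 1 + j)) - 1 / h m ^ 2 = B (fun j => h (m + 1 + j)) := by ring
    _ ≤ β₀ + Cm * γ / (1 - θ) := by rw [mul_div_assoc]; linarith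

/-- **ONE-LOOP ASYMPTOTIC SCALING OF EVERY DYNAMICAL ABEL FUNCTION.**  Under the data of `abs_dynAbel_sub_sub_chart_le` plus the value β₀ of B at the zero history and a
box solution h′ from the reference pin e′: for every `g ∈ ]0, e′]`,
**`|Λ g − Λ e′ − (1∕g² − 1∕e′²)| ≤ (8C_m∕((1 − θ)β*))·(1∕g) + (64C_m∕(3(1 − θ)β*))·e′·(β₀ + C_mγ∕(1 − θ))`**: bracket g between consecutive points `h′(m+1) < g ≤ h′(m)` of
the reference trajectory; `Λ(h′ m) − Λ e′ = mβ₀` (Abel) is within part 33's one-loop defect `(8C_m∕((1−θ)β*))·√(1∕(2e′)² + β*m∕4) ≤ (8C_m∕((1−θ)β*))∕h′(m)` of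
`1∕h′(m)² − 1∕e′²`, and the cross-over from `h′ m` to g is isometric up to `κ·h′(m)·(one chart increment)`.  The Λ-parameter IS the inverse squared coupling up to
`O(1∕g)` — sharp at this generality (part 37's square-root defect). [folklore] -/
theorem abs_dynAbel_sub_chart_le {B : (ℕ → ℝ) → ℝ} {Cm θ γ β₀ bs ta gs e' : ℝ} {t h' : ℕ → ℝ} {a : ℕ → ℝ} {Λ : ℝ → ℝ}
    (hB : MemoryProfile Cm θ γ B) (hCm : 0 ≤ Cm) (hθ0 : 0 ≤ θ) (hθ1 : θ < 1) (hbs : 0 < bs) (hta : 0 < ta)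
    (h0 : ∀ u : ℕ → ℝ, SeqBox γ u → |B u - β₀| ≤ Cm * ∑' j, θ ^ j * u j)
    (hts : SeqBox γ t) (htf : MemFlow B gs t) (hprof : ∀ m : ℕ, 1 / ta ^ 2 + bs * (m : ℝ) ≤ 1 / (t m) ^ 2)
    (hΛ : ∀ e ∈ Ioc (0 : ℝ) e', ∀ h : ℕ → ℝ, SeqBox γ h → MemFlow B e h → Tendsto (fun n => 1 / h n ^ 2 - a n) atTop (𝓝 (Λ e)))
    (he' : 0 < e') (h2e' : 2 * e' ≤ γ)
    (hs1 : 4 * Cm * e' ≤ bs * (1 - θ))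
    (hs2 : e' ^ 2 * (1 / gs ^ 2 + Cm * γ / (1 - θ) ^ 2 + (2 * Cm / ((1 - θ) * bs)) ^ 2) ≤ 3 / 4)
    (hs4 : 64 * Cm * e' ^ 3 ≤ (1 - θ) ^ 2) (hs5 : Cm * (8 * e' ^ 3 + 16 * e' / bs) ≤ (1 - θ) / 4)
    (hhs' : SeqBox γ h') (hhf' : MemFlow B e' h') {g : ℝ} (hg : 0 < g) (hge' : g ≤ e') :
    |Λ g - Λ e' - (1 / g ^ 2 - 1 / e' ^ 2)|
      ≤ 8 * Cm / ((1 - θ) * bs) * (1 / g) + 64 * Cm / (3 * (1 - θ) * bs) * e' * (β₀ + Cm * γ / (1 - θ)) := by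
  have h1θ : 0 < 1 - θ := by linarith
  have he'mem : e' ∈ Ioc (0 : ℝ) e' := ⟨he', le_rfl⟩
  -- the reference trajectory decreases to zero from e′: bracket g
  have hprof' : ∀ m : ℕ, 1 / (2 * e') ^ 2 + bs / 4 * (m : ℝ) ≤ 1 / (h' m) ^ 2 := fun m => by
    have := invSq_lower_of_reference_flow hB hCm hθ0 hθ1 hbs hta hts htf hprof hhs' hhf' hs1 hs2 m
    rwa [show (1 : ℝ) / (2 * e') ^ 2 = 1 / (4 * e' ^ 2) by ring]
  have henv : ∀ m, h' m ≤ 1 / sprof (2 * e') (bs / 4) m := fun m =>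
    le_envelope_of_reference_flow hB hCm hθ0 hθ1 hbs hta hts htf hprof he' le_rfl hhs' hhf' hs1 hs2 m
  have hlim0 : Tendsto h' atTop (𝓝 0) := by
    have hc : Tendsto (fun m => 1 / sprof (2 * e') (bs / 4) m) atTop (𝓝 0) := by
      refine Metric.tendsto_atTop.mpr fun ε hε => ?_
      obtain ⟨n₀, hn₀⟩ := EriceFlowEnclosureB12AsPrintedHistoryContagionShiftFlowRepinTail.exists_tail_scale_le
        (by positivity : (0 : ℝ) < 2 * e') (by positivity : (0 : ℝ) < bs / 4) (half_pos hε)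
      refine ⟨n₀, fun n hn => ?_⟩
      have hpos : 0 < 1 / sprof (2 * e') (bs / 4) n :=
        EriceFlowEnclosureB12AsPrintedHistoryContagionShiftFlowRepinTail.one_div_sprof_pos (by positivity) (by positivity) n
      rw [Real.dist_eq, sub_zero, abs_of_pos hpos]
      linarith [hn₀ n hn]
    exact squeeze_zero (fun m => (hhs' m).1.le) henv hc
  obtain ⟨m, hm1, hm2⟩ := exists_bracket hhf'.1 hlim0 hg hge'
  have hm0 : 0 < h' m := (hhs' m).1
  have hm0' : 0 < h' (m + 1) := (hhs' (m + 1)).1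
  have hmono := succ_le_of_reference_flow hB hCm hθ0 hθ1 hbs hta h0 hts htf hprof hhs' hhf' hs1 hs2 m
  -- (i) the cross-over from h′ m down to g: isometric up to κ·h′(m)·Δ
  have hiso := abs_dynAbel_sub_sub_chart_le hB hCm hθ0 hθ1 hbs hta hts htf hprof hΛ h2e' hs1 hs2 hs4 hs5 hg hm2 hmono.2.2
  have hΔle : 1 / g ^ 2 - 1 / h' m ^ 2 ≤ 1 / h' (m + 1) ^ 2 - 1 / h' m ^ 2 := by
    have : 1 / g ^ 2 ≤ 1 / h' (m + 1) ^ 2 := one_div_le_one_div_of_le (by positivity) (pow_le_pow_left₀ hm0'.le hm1.le 2)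
    linarith
  have hΔ0 : 0 ≤ 1 / g ^ 2 - 1 / h' m ^ 2 := by
    rw [sub_nonneg]; exact one_div_le_one_div_of_le (by positivity) (pow_le_pow_left₀ hg.le hm2 2)
  have hinc := invSq_succ_sub_le hCm hθ0 hθ1 h0 hhs' hhf' m
  have hκ : 0 ≤ 64 * Cm / (3 * (1 - θ) * bs) := by positivity
  have hI : |(Λ g - Λ (h' m)) - (1 / g ^ 2 - 1 / h' m ^ 2)| ≤ 64 * Cm / (3 * (1 - θ) * bs) * e' * (β₀ + Cm * γ / (1 - θ)) := by
    refine hiso.trans ?_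
    have h1 : 64 * Cm / (3 * (1 - θ) * bs) * h' m * (1 / g ^ 2 - 1 / h' m ^ 2)
        ≤ 64 * Cm / (3 * (1 - θ) * bs) * e' * (1 / g ^ 2 - 1 / h' m ^ 2) :=
      mul_le_mul_of_nonneg_right (mul_le_mul_of_nonneg_left hmono.2.2 hκ) hΔ0
    have h2 : 64 * Cm / (3 * (1 - θ) * bs) * e' * (1 / g ^ 2 - 1 / h' m ^ 2)
        ≤ 64 * Cm / (3 * (1 - θ) * bs) * e' * (β₀ + Cm * γ / (1 - θ)) :=
      mul_le_mul_of_nonneg_left (hΔle.trans hinc) (by positivity)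
    exact h1.trans h2
  -- (ii) climbing the reference trajectory: Abel + part 33's one-loop law
  have habel := dynAbel_shift hB hCm hθ0 hθ1 hbs hta h0 hts htf hprof hΛ he'mem hhs' hhf' hs1 hs2 m
  have hone := abs_invSq_sub_oneLoop_le_of_reference_flow hB hCm hθ0 hθ1 hbs hta h0 hts htf hprof hhs' hhf' hs1 hs2 m
  have hsprof : sprof (2 * e') (bs / 4) m ≤ 1 / g := by
    have hs0 : 0 < sprof (2 * e') (bs / 4) m := sprof_pos (by positivity) (by positivity) m
    have h1 : sprof (2 * e') (bs / 4) m ≤ 1 / h' m := (le_one_div hm0 hs0).mp (henv m)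
    exact h1.trans (one_div_le_one_div_of_le hg hm2)
  have hII : |Λ (h' m) - Λ e' - (1 / h' m ^ 2 - 1 / e' ^ 2)| ≤ 8 * Cm / ((1 - θ) * bs) * (1 / g) := by
    rw [habel]
    calc |Λ e' + (m : ℝ) * β₀ - Λ e' - (1 / h' m ^ 2 - 1 / e' ^ 2)| = |1 / h' m ^ 2 - 1 / e' ^ 2 - (m : ℝ) * β₀| := by
          rw [abs_sub_comm]; ring_nf
      _ ≤ 8 * Cm / ((1 - θ) * bs) * sprof (2 * e') (bs / 4) m := hone
      _ ≤ 8 * Cm / ((1 - θ) * bs) * (1 / g) := mul_le_mul_of_nonneg_left hsprof (by positivity)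
  -- assemble
  calc |Λ g - Λ e' - (1 / g ^ 2 - 1 / e' ^ 2)|
      = |((Λ (h' m) - Λ e' - (1 / h' m ^ 2 - 1 / e' ^ 2))) + ((Λ g - Λ (h' m)) - (1 / g ^ 2 - 1 / h' m ^ 2))| := by ring_nf
    _ ≤ |Λ (h' m) - Λ e' - (1 / h' m ^ 2 - 1 / e' ^ 2)| + |(Λ g - Λ (h' m)) - (1 / g ^ 2 - 1 / h' m ^ 2)| := abs_add_le _ _
    _ ≤ _ := add_le_add hII hI

/-- **`g²·(Λ g − Λ e′) → 1` AS `g → 0⁺`** for every dynamical Abel function near zero pin (data of `abs_dynAbel_sub_chart_le`): to leading order THE Λ-PARAMETER IS THE INVERSE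
SQUARED COUPLING — one-loop asymptotic scaling for the flow with memory (for part 35's relative Λ, `Λ e′ = 0` and `g²·Λ g → 1`). [folklore] -/
theorem tendsto_sq_mul_dynAbel {B : (ℕ → ℝ) → ℝ} {Cm θ γ β₀ bs ta gs e' : ℝ} {t h' : ℕ → ℝ} {a : ℕ → ℝ} {Λ : ℝ → ℝ}
    (hB : MemoryProfile Cm θ γ B) (hCm : 0 ≤ Cm) (hθ0 : 0 ≤ θ) (hθ1 : θ < 1) (hbs : 0 < bs) (hta : 0 < ta)
    (h0 : ∀ u : ℕ → ℝ, SeqBox γ u → |B u - β₀| ≤ Cm * ∑' j, θ ^ j * u j)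
    (hts : SeqBox γ t) (htf : MemFlow B gs t) (hprof : ∀ m : ℕ, 1 / ta ^ 2 + bs * (m : ℝ) ≤ 1 / (t m) ^ 2)
    (hΛ : ∀ e ∈ Ioc (0 : ℝ) e', ∀ h : ℕ → ℝ, SeqBox γ h → MemFlow B e h → Tendsto (fun n => 1 / h n ^ 2 - a n) atTop (𝓝 (Λ e)))
    (he' : 0 < e') (h2e' : 2 * e' ≤ γ)
    (hs1 : 4 * Cm * e' ≤ bs * (1 - θ))
    (hs2 : e' ^ 2 * (1 / gs ^ 2 + Cm * γ / (1 - θ) ^ 2 + (2 * Cm / ((1 - θ) * bs)) ^ 2) ≤ 3 / 4)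
    (hs4 : 64 * Cm * e' ^ 3 ≤ (1 - θ) ^ 2) (hs5 : Cm * (8 * e' ^ 3 + 16 * e' / bs) ≤ (1 - θ) / 4)
    (hhs' : SeqBox γ h') (hhf' : MemFlow B e' h') :
    Tendsto (fun g : ℝ => g ^ 2 * (Λ g - Λ e')) (𝓝[>] 0) (𝓝 1) := by
  have h1θ : 0 < 1 - θ := by linarith
  set L : ℝ := 8 * Cm / ((1 - θ) * bs) with hL
  set M : ℝ := 64 * Cm / (3 * (1 - θ) * bs) * e' * (β₀ + Cm * γ / (1 - θ)) with hM
  -- `g²(Λ g − Λ e′) = (1 − g²∕e′²) + g²·(defect)`, the defect being at most `L∕g + M`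
  have hmain : ∀ g ∈ Ioo (0 : ℝ) e', |g ^ 2 * (Λ g - Λ e') - 1| ≤ g ^ 2 / e' ^ 2 + (L * g + |M| * g ^ 2) := by
    intro g hg
    have hb := abs_dynAbel_sub_chart_le hB hCm hθ0 hθ1 hbs hta h0 hts htf hprof hΛ he' h2e' hs1 hs2 hs4 hs5 hhs' hhf' hg.1 hg.2.le
    have hg2 : 0 ≤ g ^ 2 := sq_nonneg g
    have hgne : g ≠ 0 := ne_of_gt hg.1
    have he'ne : e' ≠ 0 := ne_of_gt he'
    have e1 : g ^ 2 * (Λ g - Λ e') - 1 = -(g ^ 2 / e' ^ 2) + g ^ 2 * (Λ g - Λ e' - (1 / g ^ 2 - 1 / e' ^ 2)) := by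
      field_simp; ring
    rw [e1]
    calc |-(g ^ 2 / e' ^ 2) + g ^ 2 * (Λ g - Λ e' - (1 / g ^ 2 - 1 / e' ^ 2))|
        ≤ |-(g ^ 2 / e' ^ 2)| + |g ^ 2 * (Λ g - Λ e' - (1 / g ^ 2 - 1 / e' ^ 2))| := abs_add_le _ _
      _ = g ^ 2 / e' ^ 2 + g ^ 2 * |Λ g - Λ e' - (1 / g ^ 2 - 1 / e' ^ 2)| := by
          rw [abs_neg, abs_of_nonneg (by positivity), abs_mul, abs_of_nonneg hg2]
      _ ≤ g ^ 2 / e' ^ 2 + g ^ 2 * (L * (1 / g) + M) := by gcongr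
      _ ≤ g ^ 2 / e' ^ 2 + (L * g + |M| * g ^ 2) := by
          have : g ^ 2 * (L * (1 / g) + M) = L * g + M * g ^ 2 := by field_simp
          rw [this]; nlinarith [le_abs_self M]
  -- the bound tends to 0
  have hbound : Tendsto (fun g : ℝ => g ^ 2 / e' ^ 2 + (L * g + |M| * g ^ 2)) (𝓝[>] 0) (𝓝 0) := by
    have h : Tendsto (fun g : ℝ => g ^ 2 / e' ^ 2 + (L * g + |M| * g ^ 2)) (𝓝 0) (𝓝 (0 ^ 2 / e' ^ 2 + (L * 0 + |M| * 0 ^ 2))) :=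
      ((continuous_pow 2).tendsto 0 |>.div_const _).add (((continuous_const.mul continuous_id).tendsto 0).add
        (((continuous_pow 2).tendsto 0).const_mul _))
    simp only [ne_eq, OfNat.ofNat_ne_zero, not_false_eq_true, zero_pow, zero_div, mul_zero, add_zero] at h
    exact h.mono_left nhdsWithin_le_nhds
  have hev : ∀ᶠ g in 𝓝[>] (0 : ℝ), |g ^ 2 * (Λ g - Λ e') - 1| ≤ g ^ 2 / e' ^ 2 + (L * g + |M| * g ^ 2) :=
    eventually_of_mem (Ioo_mem_nhdsGT he') hmain
  have h := squeeze_zero_norm' (f := fun g : ℝ => g ^ 2 * (Λ g - Λ e') - 1)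
    (hev.mono fun g hg => by rw [Real.norm_eq_abs]; exact hg) hbound
  have := h.add_const 1
  simpa using this

end

end Summit.QuantumFields.BalabanUV.Beta.EriceFlowEnclosureB12AsPrintedHistoryContagionShiftFlowZeroIsometry
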